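import Summits.QuantumFields.YangMills.Theorems.BalabanUVNodesN21LowCentreEndSect1Letters

/-!
# N21 (NE7c) · (M1) FOR THE CHART'S OWN LETTER `χ({|B′| < M₀g_k⁻¹ε_k})` OF [LF-II] (1.2): every geometric binder of the
# re-centred END discharged in closed form; what remains displayed = PRINTED ROWS + convexity + ONE located clause

Width seat pub-ymgap-dag-n21-w1 (g0; director-ym №197 ∕ HUMAN RULING D-0149), node N21 = NE7c (single-run shell-weight
bound, NOT PRINTED in [Bałaban 1983–89], NOT proved), lane K3⁷ `SpineGivenEndpointR13SepCoPH` (stmt-QuantumFields-20544,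
`--kind proof --supports … --as helper`).  Sixth file of the seat's item-1 chain; composes BY NAME p590709 ★★★
`slotAntiConcentration_restrict_of_sect1Letters`.

WHAT.  For the SPECIES «the block's own sup-norm small-field letter» — statistic `U(z, B′) = ‖B′‖` (sup over the block's
bonds; print's `χ({|B′| < M₀g_k⁻¹ε_k})` in (1.2), desk ME #33∕#34), cut event `C = univ` (every other cut rides in the
kept convex set `K z`), envelope `{‖B′‖ < θ}` — part 28's three geometric binders are THEOREMS: radial transversality with
`κ₀ = 1` (`‖sB′‖ = s‖B′‖`), the envelope clause (`‖lB′‖ ≤ ‖B′‖`), the odds clause with `Q = 0` (the envelope IS the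
sub-level event); the statistic is `1`-Lipschitz and reads `0` at the background.  ★★★★
`slotAntiConcentration_chartLetter_of_sect1Letters`: (M1) `SlotAntiConcentration (ν|{‖B′‖<θ}) ‖·‖ θ ρ (3(#κ+1)∕(1−ρ))` for
the (1.2) block law `ν = (ζ ⊗ vol).withDensity 𝟙_{K z}e^{−φ_z}` under EXACTLY: kept CONVEX cuts containing the background,
CONVEX exponent, the (1.2) expansion identity, the PRINTED ROWS (1.9) `B16Sect1Wilson.Ineq19` ∕ (1.6) `Ineq16` as
hypotheses on the chart, the remainder's value bound, and the ONE located clause `16·W·d·(100M)^{d+1} ≤ γ₀·(θ(1−ρ))²`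
(`W = (1.6) + W_V`; p589359: it holds for g_k small since `θ = M₀ε_k∕g_k = M₀p₀(g_k) → ∞`).  §2: A6 witness.

HONEST FRAMING.  Composition BY NAME + [textbook] normed-space facts; 0 def, 0 sorry; the rows enter as HYPOTHESES (their
identification with the N21 slot's block law is this seat's located typing); the convexity of the kept cuts ∕ exponent on
the chart is a HYPOTHESIS (lens Cards 79∕81: [LF-II] (1.2)'s quadratic form + dominated remainder — located, not asserted);
nothing of Bałaban's asserted; NE7c NOT PRINTED ∕ NOT proved; N21 NOT discharged; counts unmoved (typed 28∕28 · discharged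
5∕27); count-neutral; one finite 𝕋⁴ at fixed ε — R4 would close only the conditional finite-𝕋⁴ rung `BalabanLadder.UV`,
NOT the Yang–Mills mass gap (Clay); nothing about ℝ⁴ ∕ OS.

v1.1 (g2, APPEND-ONLY; every v1 declaration byte-identical): ref-O READ-90 NITs — (i) the ledger citation tag
[Balaban1989LargeFieldII] §1 ((1.2) p.357, (1.6) p.357, (1.9) p.358) recorded at propose time; (ii) §3 `…_chartLetter_of_sect1Letters'`:
the same END with the constant SIMPLIFIED to `3(#κ+1)∕(1−ρ)`.  Successors on the exponential `SU(N)` block chart: `…EndAtSUNBlockChart`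
(p604008) ∕ `…Record` (p605099) ∕ `…Jacobian`.
-/

set_option autoImplicit false

open MeasureTheory Set Function Finset
open scoped ENNReal

namespace Summit.QuantumFields.YangMills.Theorems.N21LowCentreEndChartLetter

open Literature.MathematicalPhysics.QuantumFieldTheory.Balaban1983to89.T4ShellMeasure (SlotAntiConcentration)
open Literature.MathematicalPhysics.QuantumFieldTheory.Balaban1983to89.B16Sect1Wilson (Ineq16 Ineq19)
open Summit.QuantumFields.YangMills.Theorems.N21LowCentreEndSect1Letters (slotAntiConcentration_restrict_of_sect1Letters)

/-! ## §1  The chart-letter species: all geometric binders discharged -/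

section ChartLetter

variable {X : Type*} [MeasurableSpace X] {κ : Type*} [Fintype κ]

/-- ★★★★ **(M1) FOR THE BLOCK's OWN SUP-NORM LETTER UNDER THE (1.2) BLOCK LAW, FROM PRINTED ROWS + CONVEXITY + ONE CLAUSE.**
Statistic `‖B′‖` (sup norm of the block chart), cut `C = univ`, envelope `{‖B′‖ < θ}`: p590709's ★★★ END with `hU` (`L = 1`),
`hUc` (`σ = 0`), `henv`, `hRT` (`κ₀ = 1`), `hQ` (`Q = 0`) DISCHARGED.  Displayed: kept CONVEX cuts `K z ∋ 0`, CONVEX exponent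
`φ_z` with the (1.2) expansion `φ_z v = φ_z 0 + ½Q_z v + lin_z v + Vt_z v`, (1.9) `Ineq19 (Q_z v) (Σ_b v_b²) γ₀ d M`, (1.6)
`Ineq16 (lin_z v) B₃ M₀ A₀ p₀(g_k) R_k M`, `|Vt_z v| ≤ W_V`, and `16·W·d·(100M)^{d+1} ≤ γ₀·(θ(1−ρ))²`.
Constant `3(#κ+1)(1+0)∕(1·(1−ρ))`. [textbook] -/
theorem slotAntiConcentration_chartLetter_of_sect1Letters [Nonempty κ] (ζ : Measure X) [SFinite ζ]
    (K : X → Set (κ → ℝ)) (φ Qf lin Vt : X → (κ → ℝ) → ℝ)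
    (hg : Measurable fun p : X × (κ → ℝ) =>
      (K p.1).indicator (fun w => ENNReal.ofReal (Real.exp (-φ p.1 w))) p.2)
    {θ ρ γ₀ M B₃ M₀ A₀ p₀g Rk WV : ℝ} {d : ℕ}
    (hθ : 0 < θ) (hρ0 : 0 < ρ) (hρ1 : ρ < 1) (hd : 1 ≤ d) (hM : 0 < M) (hγ₀ : 0 < γ₀)
    (hW : 0 ≤ 3 * B₃ * M₀ * A₀ ^ 2 * p₀g ^ 2 * Real.exp (-Rk) * (100 * M) ^ 4 + WV)
    (hK : ∀ z, Convex ℝ (K z)) (hφ : ∀ z, ConvexOn ℝ (K z) (φ z)) (h0K : ∀ z, (0 : κ → ℝ) ∈ K z)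
    (hexp : ∀ z, ∀ v ∈ K z, φ z v = φ z 0 + 1 / 2 * Qf z v + lin z v + Vt z v)
    (h19 : ∀ z, ∀ v ∈ K z, Ineq19 (Qf z v) (∑ b, v b ^ 2) γ₀ d M)
    (h16 : ∀ z, ∀ v ∈ K z, Ineq16 (lin z v) B₃ M₀ A₀ p₀g Rk M)
    (hV : ∀ z, ∀ v ∈ K z, |Vt z v| ≤ WV)
    (hclause : 16 * (3 * B₃ * M₀ * A₀ ^ 2 * p₀g ^ 2 * Real.exp (-Rk) * (100 * M) ^ 4 + WV) * d
      * (100 * M) ^ (d + 1) ≤ γ₀ * (θ * (1 - ρ)) ^ 2) :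
    SlotAntiConcentration
      ((((ζ.prod volume).withDensity fun p : X × (κ → ℝ) =>
          (K p.1).indicator (fun w => ENNReal.ofReal (Real.exp (-φ p.1 w))) p.2)).restrict
        ({p : X × (κ → ℝ) | ‖p.2‖ < θ} ∩ univ))
      (fun p : X × (κ → ℝ) => ‖p.2‖) θ ρ (3 * ((Fintype.card κ : ℝ) + 1) * (1 + 0) / (1 * (1 - ρ))) := by
  have hUm : Measurable fun p : X × (κ → ℝ) => ‖p.2‖ := measurable_snd.norm
  have hEnv : MeasurableSet {p : X × (κ → ℝ) | ‖p.2‖ < θ} := measurableSet_lt hUm measurable_const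
  refine slotAntiConcentration_restrict_of_sect1Letters ζ K φ Qf lin Vt hg hUm MeasurableSet.univ hEnv
    (Env := {p : X × (κ → ℝ) | ‖p.2‖ < θ}) (σ := 0) (κ₀ := 1) (Q := 0) (L := 1)
    hθ hρ0 hρ1 (by linarith) one_pos le_rfl one_pos hd hM hγ₀ hW hK hφ h0K hexp h19 h16 hV ?_ ?_ ?_ ?_ ?_ ?_
  · -- hU: the sup norm is 1-Lipschitz
    intro _ a b
    rw [one_mul]
    exact (le_abs_self _).trans (abs_norm_sub_norm_le a b)
  · -- hUc: the background reads 0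
    intro _
    simp
  · -- the clause (σ = 0, L = 1)
    simpa using hclause
  · -- henv: `‖l • B′‖ < θ` for `l ∈ [l₀, 1]`
    intro l hl p _ h2 _
    have hl0 : 0 ≤ l := by
      have hcard : (1 : ℝ) ≤ (Fintype.card κ : ℝ) := by exact_mod_cast Fintype.card_pos
      have : 1 / ((Fintype.card κ : ℝ) + 1) ≤ 1 := by
        rw [div_le_one (by positivity)]
        linarith
      linarith [hl.1]
    show ‖(0 : κ → ℝ) + l • (p.2 - 0)‖ < θ
    rw [zero_add, sub_zero, norm_smul, Real.norm_of_nonneg hl0]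
    calc l * ‖p.2‖ ≤ 1 * ‖p.2‖ := mul_le_mul_of_nonneg_right hl.2 (norm_nonneg _)
      _ = ‖p.2‖ := one_mul _
      _ < θ := h2
  · -- hRT: `‖s • B′‖ = s‖B′‖`, so the statistic grows at rate `‖B′‖ ≥ θ(1−ρ)` per unit dilation (κ₀ = 1)
    intro p h1 _ _ s hs _ _ _
    show ‖p.2‖ + 1 * (θ * (1 - ρ)) * (s - 1) ≤ ‖(0 : κ → ℝ) + s • (p.2 - 0)‖
    rw [zero_add, sub_zero, norm_smul, Real.norm_of_nonneg (by linarith : (0 : ℝ) ≤ s)]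
    have h1' : θ * (1 - ρ) ≤ ‖p.2‖ := h1
    nlinarith [mul_le_mul_of_nonneg_left h1' (show (0 : ℝ) ≤ s - 1 by linarith)]
  · -- hQ: the envelope IS the sub-level event (Q = 0)
    have hempty : {p : X × (κ → ℝ) | ‖p.2‖ < θ} \ ({p : X × (κ → ℝ) | ‖p.2‖ < θ} ∩ univ) = ∅ := by
      ext p
      simp
    rw [hempty, measure_empty]
    exact zero_le

end ChartLetter

/-! ## §2  A6 witness: every binder of the ★★★★ END discharged, the clause with equality -/

section Witness

open Summit.QuantumFields.YangMills.Theorems.N21LowCentreEndSect1Letters (convexOn_halfSq_one)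

/-- **A6 WITNESS OF THE ★★★★ END** (director-ym STANDING A6 RULE №189 (3)): `X = Unit` (dirac), block `ℝ¹`, `K = univ`,
`φ(w) = w₀²∕2` (expansion `Q w = w₀²`, `lin = 0`, `Vt = 0`), rows at `γ₀ = 1`, `d = 1`, `M = 1∕100`, `B₃ = 1∕48`,
`M₀ = A₀ = p₀(g) = 1`, `R_k = 0` (`W = 1∕16`), letter `θ = 2`, `ρ = ½`: the clause `16·(1∕16)·1·1 = 1 = 1·(2·½)²`
WITH EQUALITY.  A satisfiability witness, not an estimate on Bałaban's measure. [textbook] -/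
theorem chartLetter_binders_inhabited :
    SlotAntiConcentration
      ((((Measure.dirac ()).prod (volume : Measure (Fin 1 → ℝ))).withDensity
          fun p : Unit × (Fin 1 → ℝ) =>
            (univ : Set (Fin 1 → ℝ)).indicator (fun w => ENNReal.ofReal (Real.exp (-(w 0 ^ 2 / 2)))) p.2).restrict
        ({p : Unit × (Fin 1 → ℝ) | ‖p.2‖ < 2} ∩ univ))
      (fun p : Unit × (Fin 1 → ℝ) => ‖p.2‖) 2 (1 / 2)
      (3 * ((Fintype.card (Fin 1) : ℝ) + 1) * (1 + 0) / (1 * (1 - 1 / 2))) := by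
  have hφm : Measurable fun w : Fin 1 → ℝ => w 0 ^ 2 / 2 := ((measurable_pi_apply 0).pow_const 2).div_const 2
  have hg : Measurable fun p : Unit × (Fin 1 → ℝ) =>
      (univ : Set (Fin 1 → ℝ)).indicator (fun w => ENNReal.ofReal (Real.exp (-(w 0 ^ 2 / 2)))) p.2 := by
    simp only [indicator_univ]
    exact (ENNReal.measurable_ofReal.comp (Real.measurable_exp.comp hφm.neg)).comp measurable_snd
  refine slotAntiConcentration_chartLetter_of_sect1Letters (Measure.dirac ()) (fun _ => univ) (fun _ w => w 0 ^ 2 / 2)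
    (fun _ w => w 0 ^ 2) (fun _ _ => 0) (fun _ _ => 0) hg (γ₀ := 1) (M := 1 / 100) (B₃ := 1 / 48) (M₀ := 1)
    (A₀ := 1) (p₀g := 1) (Rk := 0) (WV := 0) (d := 1) two_pos (by norm_num) (by norm_num) le_rfl (by norm_num) one_pos
    ?_ (fun _ => convex_univ) (fun _ => convexOn_halfSq_one) (fun _ => mem_univ _) ?_ ?_ ?_ ?_ ?_
  · simp
  · intro _ v _
    simp only [Pi.zero_apply]
    ring
  · intro _ v _
    unfold Ineq19
    simp only [Fin.sum_univ_one, Nat.cast_one]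
    norm_num
    nlinarith [sq_nonneg (v 0)]
  · intro _ v _
    unfold Ineq16
    norm_num
  · intro _ v _
    simp
  · norm_num

end Witness

/-! ## §3 (v1.1)  The chart-letter species with the constant simplified (ref-O READ-90 NIT (i)) -/

section ChartLetterSimp

variable {X : Type*} [MeasurableSpace X] {κ : Type*} [Fintype κ]

/-- ★★★★′ §1's END with the constant written as `3(#κ+1)∕(1−ρ)` (`(1+0)∕(1·(1−ρ)) = 1∕(1−ρ)`). [textbook] -/
theorem slotAntiConcentration_chartLetter_of_sect1Letters' [Nonempty κ] (ζ : Measure X) [SFinite ζ]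
    (K : X → Set (κ → ℝ)) (φ Qf lin Vt : X → (κ → ℝ) → ℝ)
    (hg : Measurable fun p : X × (κ → ℝ) =>
      (K p.1).indicator (fun w => ENNReal.ofReal (Real.exp (-φ p.1 w))) p.2)
    {θ ρ γ₀ M B₃ M₀ A₀ p₀g Rk WV : ℝ} {d : ℕ}
    (hθ : 0 < θ) (hρ0 : 0 < ρ) (hρ1 : ρ < 1) (hd : 1 ≤ d) (hM : 0 < M) (hγ₀ : 0 < γ₀)
    (hW : 0 ≤ 3 * B₃ * M₀ * A₀ ^ 2 * p₀g ^ 2 * Real.exp (-Rk) * (100 * M) ^ 4 + WV)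
    (hK : ∀ z, Convex ℝ (K z)) (hφ : ∀ z, ConvexOn ℝ (K z) (φ z)) (h0K : ∀ z, (0 : κ → ℝ) ∈ K z)
    (hexp : ∀ z, ∀ v ∈ K z, φ z v = φ z 0 + 1 / 2 * Qf z v + lin z v + Vt z v)
    (h19 : ∀ z, ∀ v ∈ K z, Ineq19 (Qf z v) (∑ b, v b ^ 2) γ₀ d M)
    (h16 : ∀ z, ∀ v ∈ K z, Ineq16 (lin z v) B₃ M₀ A₀ p₀g Rk M)
    (hV : ∀ z, ∀ v ∈ K z, |Vt z v| ≤ WV)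
    (hclause : 16 * (3 * B₃ * M₀ * A₀ ^ 2 * p₀g ^ 2 * Real.exp (-Rk) * (100 * M) ^ 4 + WV) * d
      * (100 * M) ^ (d + 1) ≤ γ₀ * (θ * (1 - ρ)) ^ 2) :
    SlotAntiConcentration
      ((((ζ.prod volume).withDensity fun p : X × (κ → ℝ) =>
          (K p.1).indicator (fun w => ENNReal.ofReal (Real.exp (-φ p.1 w))) p.2)).restrict
        ({p : X × (κ → ℝ) | ‖p.2‖ < θ} ∩ univ))
      (fun p : X × (κ → ℝ) => ‖p.2‖) θ ρ (3 * ((Fintype.card κ : ℝ) + 1) / (1 - ρ)) := by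
  have h := slotAntiConcentration_chartLetter_of_sect1Letters ζ K φ Qf lin Vt hg hθ hρ0 hρ1 hd hM hγ₀ hW hK hφ h0K hexp
    h19 h16 hV hclause
  have hc : 3 * ((Fintype.card κ : ℝ) + 1) * (1 + 0) / (1 * (1 - ρ)) = 3 * ((Fintype.card κ : ℝ) + 1) / (1 - ρ) := by
    rw [add_zero, mul_one, one_mul]
  rwa [hc] at h

end ChartLetterSimp

end Summit.QuantumFields.YangMills.Theorems.N21LowCentreEndChartLetter
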